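import Summits.ResolutionOfSingularities.ResolutionOfSingularities.Theorems.WeightedInvariantIota3RatioOneDominancePrelims
import HarnessLib

/-!
# Dominance word, RATIO-ONE REGIME `r₁ = r₂ = r > q` (memo (6b) of res-D-brk-1's O70B-JCAN-PLAN), the core lemma:
# two reaching flags WITH A COMMON SECOND MEMBER dominate each other — including the memo's «open sub-case» `V̄ ∣ B̄`
# (door `HypersurfaceCentreConstruction`, stmt-ResolutionOfSingularities-19897; P3 rung clause h8 ⟸ (σ-pres)₃ ⟸ the ONE dominance word
# `TwoFlagDominanceAtLevelLE3Body p`, regime `a = b`)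

Topic: `Summits/ResolutionOfSingularities/ResolutionOfSingularities/Theorems`. Helper for the door item `HypersurfaceCentreConstruction`
(stmt-ResolutionOfSingularities-19897, route `WeightedInvariant`), line `local-engine`, def-free.  The dominance word
`Iota3.TwoFlagDominanceAtLevelAt f` (…Iota3DominanceWordsDefs) in the regime `a = b` (maximal reached ratio `r₁/r₂ = 1`, so the triple is
`(q; r, r)`) asks: for two two-flags `Φ = (g₁, g₂)`, `Φ' = (g₁', g₂')` both carrying `f` to level `rν` of their `(q; r, r)`-filtrations,
`g₁', g₂' ∈ F_Φ(r) = (g₁, g₂) + 𝔪^⌈r/q⌉`.  The landed parts of the word treat `r₂ = q` (PART 1, …JSigmaDominanceGeneric) and `r₂ < r₁`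
((E1), …JSigmaDominanceSecondMember); the ratio-one regime `r₁ = r₂ = r > q` was the memo's §6b «notes for the next session», with the
sub-case «the common direction divides the tangent form» left OPEN there.  THIS FILE proves the core of §6b with NO such proviso:

PART 1 (…Iota3RatioOneDominancePrelims): `F ≤ 𝔪ᵏ`, the weighted valuation on products/powers, `c·wʲ ∉ (y) + 𝔪^{j+1}` for a two-flag
`(y, w)`, and the Φ-side bookkeeping `exists_unit_coeff_of_reaches_ratio_one`.  THIS FILE (PART 2):
* **`Iota3.mem_weight_of_reaches_ratio_one_of_common`** — THE CORE LEMMA: `S` regular local of dimension `3`, `𝔪 = (x, w, y')`, `(y, w)` a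
  two-flag, `0 < q < r`, `f ∈ F_{(y,w)}(rν) ∩ F_{(y',w)}(rν)`, `f ∉ (w^ν) + 𝔪^{ν+1}` ⇒ `y ∈ F_{(y',w)}(r)`.
  Proof: if `y ∈ F'(a) ∖ F'(a+1)` with `a < r`, the bookkeeping gives `f = y^{ν−j₀}·E + R` with `R ∈ F'(Ω+1)`,
  `Ω = (ν−j₀)a + j₀r < rν`, `E = c w^{j₀} + p + y g`; `E ∉ F'(j₀r+1)` (else `c w^{j₀} ∈ (y) + 𝔪^{j₀+1}`), so the valuation property puts
  `y^{ν−j₀}E` outside `F'(Ω+1)` — but `y^{ν−j₀}E = f − R ∈ F'(Ω+1)`.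
The passage from two ARBITRARY two-flags to a common second member (the DVR `S/(g₁', g₂')`) and the unit-coefficient hypothesis from the
maximal-ratio clause (`f ∈ (w^ν) + 𝔪^{ν+1}` ⇒ `(w, ·)` reaches `(ν; ν+1, ν)`, ratio `> 1`) are NOT in this file.

[OURS · L1 W4.3 · (o70-b)/(Δ12) §6b]  Replaces the role of NO printed item; NOT a statement of the manuscript [claim: Hironaka2017,
status: under-review]. AI work, weaker than expert review.  Pure commutative algebra; no named facts; no definition.

## References

* V. Cossart, U. Jannsen, S. Saito, *Desingularization: invariants and strategy*, LNM 2270 (2020), Def. 8.2, Lemma 8.3. [CossartJannsenSaito2020]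
* H. Hironaka, *Characteristic polyhedra of singularities*, J. Math. Kyoto Univ. 7 (1967), §1. [Hironaka1967]
* res-D-brk-1, `D/res-D-brk-1/O70B-JCAN-PLAN.md` §6b (OURS, AI analysis, 2026-08-27).
-/

noncomputable section

set_option linter.dupNamespace false -- mandated namespace `Summit.<Summit>.<Problem>` of this single-conjunct summit

open IsLocalRing Literature.AlgebraicGeometry.Resolution
open Summit.ResolutionOfSingularities.ResolutionOfSingularities.Theorems

namespace Summit.ResolutionOfSingularities.ResolutionOfSingularities.Cruxes.HypersurfaceCentreConstruction.LocalEngine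

namespace Iota3

/-! ## §5 The core lemma: ratio-one dominance for two reaching flags with a common second member -/

section Core

variable {S : Type} [CommRing S] [IsRegularLocalRing S]

/-- **RATIO-ONE DOMINANCE, COMMON SECOND MEMBER.**  `S` regular local of dimension `3`, `𝔪 = (x, w, y')`, `(y, w)` a two-flag,
`0 < q < r`; if `f` lies in level `rν` of the `(q; r, r)`-filtrations of BOTH `(y, w)` and `(y', w)` and `f ∉ (w^ν) + 𝔪^{ν+1}`,
then `y ∈ F_{(y',w)}(r) = (y', w) + 𝔪^⌈r/q⌉`.  No maximality and no proviso on the tangent form beyond `f ∉ (w^ν) + 𝔪^{ν+1}`.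
Proof: with `y ∈ F'(a) ∖ F'(a+1)`, `a < r`, the Φ-side bookkeeping gives `f = y^{ν−j₀}E + R`, `R ∈ F'(Ω+1)`, `Ω = (ν−j₀)a + j₀r < rν`,
`E = c w^{j₀} + p + y g ∉ F'(j₀r+1)` (else `c w^{j₀} ∈ (y) + 𝔪^{j₀+1}`); the valuation property contradicts `y^{ν−j₀}E = f − R ∈ F'(Ω+1)`.
[OURS · L1 W4.3 · (o70-b) §6b] -/
theorem mem_weight_of_reaches_ratio_one_of_common (hdim : ringKrullDim S = (3 : ℕ)) {x y y' w f : S} {q r ν : ℕ}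
    (h𝔪 : Ideal.span {x, w, y'} = maximalIdeal S) (hyw : IsTwoFlag y w) (hq : 0 < q) (hqr : q < r)
    (hF : f ∈ flagContactFiltration y w q r r (r * ν))
    (hF' : f ∈ flagContactFiltration y' w q r r (r * ν))
    (hNP : f ∉ Ideal.span {w ^ ν} ⊔ maximalIdeal S ^ (ν + 1)) :
    y ∈ flagContactFiltration y' w q r r r := by
  classical
  have hy'm : y' ∈ maximalIdeal S := h𝔪 ▸ Ideal.subset_span (by simp)
  have hwm : w ∈ maximalIdeal S := hyw.2.1
  have hym : y ∈ maximalIdeal S := hyw.1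
  by_contra hy
  -- `a := max {n ≤ r | y ∈ F'(n)}`, `q ≤ a < r`
  set P : ℕ → Prop := fun n => y ∈ flagContactFiltration y' w q r r n with hP
  set a := Nat.findGreatest P r with ha
  have hPq : P q := maximalIdeal_le_flagContactFiltration y' w r r hq hym
  have hPa : y ∈ flagContactFiltration y' w q r r a := Nat.findGreatest_spec (P := P) hqr.le hPq
  have hqa : q ≤ a := Nat.le_findGreatest hqr.le hPq
  have har : a ≤ r := Nat.findGreatest_le r
  have hane : a ≠ r := fun h => hy (by rw [h] at hPa; exact hPa)
  have har' : a + 1 ≤ r := by omega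
  have hnot : y ∉ flagContactFiltration y' w q r r (a + 1) :=
    Nat.findGreatest_is_greatest (P := P) (Nat.lt_succ_self a) har'
  -- the Φ-side bookkeeping
  obtain ⟨j₀, c, hj₀, hc, hrest⟩ := exists_unit_coeff_of_reaches_ratio_one hym hwm hq hqr hF hNP
  obtain ⟨k, hk⟩ : ∃ k, ν - j₀ = k + 1 := ⟨ν - j₀ - 1, by omega⟩
  -- `LOW ≤ F'(Ω+1)`, `Ω = (ν − j₀)a + j₀ r`
  have hLOW : (⨆ α, ⨆ β, ⨆ (_ : α + β ≤ ν), ⨆ (_ : α + j₀ < ν),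
      Ideal.span {y ^ α * w ^ β} * maximalIdeal S ^ ((r * ν - r * α - r * β + q - 1) / q)) ≤
      flagContactFiltration y' w q r r ((ν - j₀) * a + j₀ * r + 1) := by
    refine iSup_le fun α => iSup_le fun β => iSup_le fun hαβ => iSup_le fun hα => ?_
    rw [Ideal.mul_le]
    intro u hu m hm
    obtain ⟨d, rfl⟩ := Ideal.mem_span_singleton'.mp hu
    have hce : r * ν - r * α - r * β ≤ q * ((r * ν - r * α - r * β + q - 1) / q) := by
      have h := Nat.lt_div_mul_add (a := r * ν - r * α - r * β + q - 1) hq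
      have h' := mul_comm ((r * ν - r * α - r * β + q - 1) / q) q
      omega
    set e := (r * ν - r * α - r * β + q - 1) / q
    rw [mul_sub_sub_eq] at hce
    have h1 : y ^ α ∈ flagContactFiltration y' w q r r (a * α) :=
      pow_le_flagContactFiltration_mul y' w r r hq a α (Ideal.pow_mem_pow hPa α)
    have h2 : y' ^ 0 * w ^ β * m ∈ flagContactFiltration y' w q r r (r * β + q * e) :=
      mul_mem_flagContactFiltration_of_weight hq hm (by omega)
    have h3 : y ^ α * (y' ^ 0 * w ^ β * m) ∈ flagContactFiltration y' w q r r (a * α + (r * β + q * e)) :=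
      flagContactFiltration_mul_le y' w q r r hq _ _ (Ideal.mul_mem_mul h1 h2)
    have heq : d * (y ^ α * w ^ β) * m = d * (y ^ α * (y' ^ 0 * w ^ β * m)) := by ring
    rw [heq]
    refine Ideal.mul_mem_left _ d (flagContactFiltration_antitone y' w q r r ?_ h3)
    -- `Ω + 1 ≤ aα + rβ + qe`
    obtain ⟨s, hs⟩ : ∃ s, ν = α + β + s := ⟨ν - α - β, by omega⟩
    have hs' : ν - α - β = s := by omega
    rw [hs'] at hce
    obtain ⟨t, ht1, ht2⟩ : ∃ t, ν - j₀ = α + t + 1 ∧ β + s = j₀ + t + 1 := ⟨ν - j₀ - α - 1, by omega, by omega⟩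
    rw [ht1]
    have h5 : a * t ≤ r * t := Nat.mul_le_mul_right t (by omega)
    have h6 : (α + t + 1) * a = a * α + a * t + a := by ring
    have h7 : r * β + r * s = j₀ * r + r * t + r := by rw [← Nat.mul_add, ht2]; ring
    omega
  -- the decomposition `f − c·y^{ν−j₀} w^{j₀} = y^{ν−j₀} p + g y^{ν−j₀+1} + ρ'`
  obtain ⟨AB, hAB, ρ', hρ', hsum⟩ := Submodule.mem_sup.mp hrest
  obtain ⟨A, hA, B, hB, hAB'⟩ := Submodule.mem_sup.mp hAB
  obtain ⟨p, hp, rfl⟩ := Ideal.mem_span_singleton_mul.mp hA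
  obtain ⟨g, rfl⟩ := Ideal.mem_span_singleton'.mp hB
  have hρ'F : ρ' ∈ flagContactFiltration y' w q r r ((ν - j₀) * a + j₀ * r + 1) := hLOW hρ'
  -- `E`
  set E := c * w ^ j₀ + p + y * g with hE
  have hfE : f = y ^ (ν - j₀) * E + ρ' := by
    have h1 : f = c * (y ^ (ν - j₀) * w ^ j₀) + (y ^ (ν - j₀) * p + g * y ^ (ν - j₀ + 1) + ρ') := by
      rw [hAB', hsum]; ring
    rw [h1, hE]
    ring
  -- `y^{ν−j₀} E ∈ F'(Ω+1)`
  have hΩν : (ν - j₀) * a + j₀ * r + 1 ≤ r * ν := by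
    have h1 : (a + 1) * (k + 1) ≤ r * (k + 1) := Nat.mul_le_mul_right _ har'
    have h2 : r * ν = r * (k + 1) + r * j₀ := by rw [← Nat.mul_add]; congr 1; omega
    have h3 : (a + 1) * (k + 1) = (k + 1) * a + (k + 1) := by ring
    rw [hk]
    have h4 : j₀ * r = r * j₀ := mul_comm _ _
    omega
  have hyE : y ^ (ν - j₀) * E ∈ flagContactFiltration y' w q r r ((ν - j₀) * a + j₀ * r + 1) := by
    have h1 : y ^ (ν - j₀) * E = f - ρ' := by rw [hfE]; ring
    rw [h1]
    exact Ideal.sub_mem _ (flagContactFiltration_antitone y' w q r r hΩν hF') hρ'F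
  -- `E ∉ F'(j₀ r + 1)`
  have hEnot : E ∉ flagContactFiltration y' w q r r (j₀ * r + 1) := by
    intro hEin
    have hP𝔪 : (⨆ β, ⨆ (_ : β < j₀), Ideal.span {w ^ β} * maximalIdeal S ^ ((r * (j₀ - β) + q - 1) / q)) ≤
        maximalIdeal S ^ (j₀ + 1) := by
      refine iSup_le fun β => iSup_le fun hβ => ?_
      have hce : r * (j₀ - β) ≤ q * ((r * (j₀ - β) + q - 1) / q) := by
        have h := Nat.lt_div_mul_add (a := r * (j₀ - β) + q - 1) hq
        have h' := mul_comm ((r * (j₀ - β) + q - 1) / q) q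
        omega
      set e := (r * (j₀ - β) + q - 1) / q
      have hwβ : Ideal.span {w ^ β} ≤ maximalIdeal S ^ β :=
        (Ideal.span_singleton_le_iff_mem _).mpr (Ideal.pow_mem_pow hwm β)
      have hexp : j₀ + 1 ≤ β + e := by
        by_contra hlt
        have hem : e ≤ j₀ - β := by omega
        have h1 := Nat.mul_le_mul_left q hem
        have h2 : q * (j₀ - β) < r * (j₀ - β) := Nat.mul_lt_mul_of_pos_right hqr (by omega)
        omega
      calc Ideal.span {w ^ β} * maximalIdeal S ^ e ≤ maximalIdeal S ^ β * maximalIdeal S ^ e := Ideal.mul_mono_left hwβ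
        _ = maximalIdeal S ^ (β + e) := (pow_add _ _ _).symm
        _ ≤ maximalIdeal S ^ (j₀ + 1) := Ideal.pow_le_pow_right hexp
    have hF'𝔪 : flagContactFiltration y' w q r r (j₀ * r + 1) ≤ maximalIdeal S ^ (j₀ + 1) :=
      flagContactFiltration_le_pow_of_lt hy'm hwm hq hqr.le (by
        have : r * (j₀ + 1) = j₀ * r + r := by ring
        omega)
    have hcw : c * w ^ j₀ ∈ Ideal.span {y} ⊔ maximalIdeal S ^ (j₀ + 1) := by
      have h1 : c * w ^ j₀ = E - p - y * g := by rw [hE]; ring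
      rw [h1]
      refine Ideal.sub_mem _ (Ideal.sub_mem _ (Ideal.mem_sup_right (hF'𝔪 hEin)) (Ideal.mem_sup_right (hP𝔪 hp))) ?_
      exact Ideal.mem_sup_left (Ideal.mul_mem_right _ _ (Ideal.mem_span_singleton_self y))
    exact not_mem_span_sup_pow_of_isTwoFlag hdim hyw hc j₀ hcw
  -- `e₀ := max {n ≤ j₀ r | E ∈ F'(n)}`
  set Q : ℕ → Prop := fun n => E ∈ flagContactFiltration y' w q r r n with hQ
  set e₀ := Nat.findGreatest Q (j₀ * r) with he₀
  have hQ0 : Q 0 := by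
    show E ∈ flagContactFiltration y' w q r r 0
    rw [flagContactFiltration_zero y' w q r r hq]
    trivial
  have hEe : E ∈ flagContactFiltration y' w q r r e₀ := Nat.findGreatest_spec (P := Q) (Nat.zero_le _) hQ0
  have he₀le : e₀ ≤ j₀ * r := Nat.findGreatest_le _
  have hEnot' : E ∉ flagContactFiltration y' w q r r (e₀ + 1) := by
    rcases he₀le.eq_or_lt with h | h
    · rw [h]
      exact hEnot
    · exact Nat.findGreatest_is_greatest (P := Q) (Nat.lt_succ_self e₀) h
  -- the valuation on the regular system `(x, w, y'; q, r, r)`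
  have hdim' : ringKrullDim S = 3 := by rw [hdim]; rfl
  have hw3 : ∀ i, 0 < (![q, r, r] : Fin 3 → ℕ) i := by
    intro i
    fin_cases i
    · exact hq
    · exact hq.trans hqr
    · exact hq.trans hqr
  have hgen : Ideal.span {(![x, w, y'] : Fin 3 → S) 0, (![x, w, y'] : Fin 3 → S) 1, (![x, w, y'] : Fin 3 → S) 2} =
      maximalIdeal S := by
    simpa using h𝔪
  have hbridge : ∀ n, flagContactFiltration y' w q r r n = weightedIdealW ![x, w, y'] ![q, r, r] n := fun n => by
    rw [flagContactFiltration_eq_weightedMonomialIdeal h𝔪 hq hqr.le hqr.le n, CrossingPoint.weightedMonomialIdeal_eq_weightedIdealW]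
  have hk1 : 1 ≤ ν - j₀ := by omega
  obtain ⟨hyk, hyk'⟩ := pow_mem_not_mem_weightedIdealW ![x, w, y'] hgen hdim' hw3 (g := y) (a := a)
    (by rw [← hbridge]; exact hPa) (by rw [← hbridge]; exact hnot) hk1
  have hval := mul_not_mem_weightedIdealW_succ ![x, w, y'] hgen hdim' hw3 hyk hyk'
    (by rw [← hbridge]; exact hEe) (by rw [← hbridge]; exact hEnot')
  rw [← hbridge] at hval
  exact hval (flagContactFiltration_antitone y' w q r r (by omega) hyE)

end Core

end Iota3

end Summit.ResolutionOfSingularities.ResolutionOfSingularities.Cruxes.HypersurfaceCentreConstruction.LocalEngine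

end
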